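import Summits.KontsevichZagierPeriods.Zeta5Search.TwoTaleOmega.StepAEF
import Summits.KontsevichZagierPeriods.Zeta5Search.TwoTaleOmega.AefInstKit

/-!
# (bmiss)@Ω — direction `aef`, instantiation kit II: block values at numeral lengths (cell `pub-zeta5`, cert-2 gen 5)

HONEST FRAMING: systematic search; recurrence certificates; no irrationality claim unless certified. Pure bookkeeping; no named fact,
no `sorry`.

`simp`-shaped evaluations `(block b (b+n)).eval t` for `n = 1,…,6` (from `StepBL.eval_block_123`, `StepAEFR.eval_block_46`), used by the
81 generated family files `AefInst*` to identify cert-2's linear-form atoms `lprod …` with the block-value atoms of `StepAEFR.IdRb` / the factor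
atoms of `StepAEFL.IdL`.
-/

noncomputable section

open Finset Polynomial
open Literature.NumberTheory.Irrationality.Zudilin2014
open Summit.KontsevichZagierPeriods.Zeta5Search.FormalBarnes

namespace Summit.KontsevichZagierPeriods.Zeta5Search.TwoTaleOmega

/-- `(block b (b+1)).eval t = t + b`. -/
theorem evb1 (b : ℤ) (t : ℚ) : (block b (b + 1)).eval t = t + b := (Pt.eval_block_123 b t).1
/-- `(block b (b+2)).eval t`. -/
theorem evb2 (b : ℤ) (t : ℚ) : (block b (b + 2)).eval t = (t + b) * (t + b + 1) := (Pt.eval_block_123 b t).2.1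
/-- `(block b (b+3)).eval t`. -/
theorem evb3 (b : ℤ) (t : ℚ) : (block b (b + 3)).eval t = (t + b) * (t + b + 1) * (t + b + 2) := (Pt.eval_block_123 b t).2.2
/-- `(block b (b+4)).eval t`. -/
theorem evb4 (b : ℤ) (t : ℚ) : (block b (b + 4)).eval t = (t + b) * (t + b + 1) * (t + b + 2) * (t + b + 3) := (Pt.eval_block_46 b t).1
/-- `(block b (b+6)).eval t`. -/
theorem evb6 (b : ℤ) (t : ℚ) :
    (block b (b + 6)).eval t = (t + b) * (t + b + 1) * (t + b + 2) * (t + b + 3) * (t + b + 4) * (t + b + 5) := (Pt.eval_block_46 b t).2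

end Summit.KontsevichZagierPeriods.Zeta5Search.TwoTaleOmega

end
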